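import Mathlib

/-!
# Ternary branching from the CM sphere (ENGINE B, pub-hlocus abs-2 g50) — helper anchor

certified instances and evidence bearing on the general Hodge conjecture; no claim.

Algebraic core of THEOREM TERNARY (DERIVATIONS_engineB §67.1). All normalised optimal embeddings of one
3-ramified type lie on one level set `X^2 + 3*Y^2 + 3*W^2 = c` of the ternary norm form (c = ±12 after
normalisation, so `3 ∣ X`). Two points of the SAME node of odd θ-level `2k+1` (k ≥ 1) satisfy
`3^(k+1) ∣ X - X'`, `3^k ∣ Y - Y'`, `3^k ∣ W - W'`; the children of that node are indexed by the next digits of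
`Y` and `W` (nine candidates). The sphere identity
`(X - X') * (X + X') = -3 * ((Y - Y') * (Y + Y') + (W - W') * (W + W'))`
then FORCES the next `Y`-digit on a node of the ζ₃ REAL camp (`Y` a 3-adic unit, `3 ∣ W`), the next
`W`-digit on a node of the IMAGINARY camp (`3 ∣ Y`, `W` a unit), and confines the digit pair to one line of
`𝔽₃²` on a √3 node (both units): at most 3 of the 9 candidate children are occupied. Even levels branch into
the three `X`-digits trivially, and the root (level 1) has the 4 children `Y^2 + W^2 ≡ c/3 (mod 3)`.
Registered mechanism checks (0 violations / 71 458 ζ₃ nodes, D ≤ 4800; 0 / 54 924 √3 nodes, D ≤ 3900) are in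
ABSHODGE.md (block 'ENGINE B — TREE LAWS DERIVED').
-/

set_option linter.dupNamespace false

namespace Summit.HodgeConjecture.HodgeConjecture.HodgeLocus.Census.TernaryBranchB

/-- The sphere identity for two points of one level set of `X² + 3Y² + 3W²`. -/
theorem sphere_identity (X X' Y Y' W W' c : ℤ) (hs : X ^ 2 + 3 * Y ^ 2 + 3 * W ^ 2 = c)
    (hs' : X' ^ 2 + 3 * Y' ^ 2 + 3 * W' ^ 2 = c) :
    (X - X') * (X + X') = -3 * ((Y - Y') * (Y + Y') + (W - W') * (W + W')) := by
  linear_combination hs - hs'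

/-- Divisibility transported along a node: if `3 ∣ W` and `3^k ∣ W - W'` with `k ≥ 1` then `3 ∣ W'`. -/
theorem dvd_of_node (W W' : ℤ) (k : ℕ) (hk : 1 ≤ k) (hW : 3 ∣ W) (hdW : 3 ^ k ∣ W - W') : 3 ∣ W' := by
  have h3k : (3 : ℤ) ∣ 3 ^ k := dvd_pow_self 3 (by omega)
  have h := dvd_sub hW (dvd_trans h3k hdW)
  simpa using h

/-- A unit stays a unit along a node, and the SUM of the two coordinates is a unit:
if `¬ 3 ∣ Y` and `3^k ∣ Y - Y'` with `k ≥ 1` then `¬ 3 ∣ Y + Y'`. -/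
theorem sum_not_dvd (Y Y' : ℤ) (k : ℕ) (hk : 1 ≤ k) (hY : ¬ 3 ∣ Y) (hdY : 3 ^ k ∣ Y - Y') :
    ¬ 3 ∣ Y + Y' := by
  have h3k : (3 : ℤ) ∣ 3 ^ k := dvd_pow_self 3 (by omega)
  have hY3 : (3 : ℤ) ∣ Y - Y' := dvd_trans h3k hdY
  intro h
  apply hY
  have h2 : (3 : ℤ) ∣ 2 * Y := by
    have h' := dvd_add h hY3
    rw [show Y + Y' + (Y - Y') = 2 * Y by ring] at h'
    exact h'
  rcases Int.prime_three.dvd_mul.mp h2 with h' | h'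
  · exfalso; revert h'; decide
  · exact h'

/-- The common step: inside a node of odd level `2k+1` the combination
`(Y - Y')(Y + Y') + (W - W')(W + W')` is divisible by `3^(k+1)`. -/
theorem node_combination (X X' Y Y' W W' c : ℤ) (k : ℕ)
    (hs : X ^ 2 + 3 * Y ^ 2 + 3 * W ^ 2 = c) (hs' : X' ^ 2 + 3 * Y' ^ 2 + 3 * W' ^ 2 = c)
    (hX : 3 ∣ X) (hX' : 3 ∣ X') (hdX : 3 ^ (k + 1) ∣ X - X') :
    3 ^ (k + 1) ∣ (Y - Y') * (Y + Y') + (W - W') * (W + W') := by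
  have hid := sphere_identity X X' Y Y' W W' c hs hs'
  have h1 : (3 : ℤ) * 3 ^ (k + 1) ∣ (X - X') * (X + X') := by
    have := mul_dvd_mul hdX (dvd_add hX hX')
    calc (3 : ℤ) * 3 ^ (k + 1) = 3 ^ (k + 1) * 3 := by ring
      _ ∣ (X - X') * (X + X') := this
  rw [hid] at h1
  have h2 : (3 : ℤ) * 3 ^ (k + 1) ∣ 3 * (-((Y - Y') * (Y + Y') + (W - W') * (W + W'))) := by
    convert h1 using 1
    ring
  have h3 := (mul_dvd_mul_iff_left (by norm_num : (3 : ℤ) ≠ 0)).mp h2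
  exact (dvd_neg).mp h3

/-- THEOREM TERNARY, REAL-camp case: on a node of odd level `2k+1` (k ≥ 1) of the ζ₃ REAL camp
(`Y` a unit, `3 ∣ W`) the next `Y`-digit is forced: `3^(k+1) ∣ Y - Y'`. Hence the node has at most the three
children indexed by the next `W`-digit. -/
theorem forced_Y_digit (X X' Y Y' W W' c : ℤ) (k : ℕ) (hk : 1 ≤ k)
    (hs : X ^ 2 + 3 * Y ^ 2 + 3 * W ^ 2 = c) (hs' : X' ^ 2 + 3 * Y' ^ 2 + 3 * W' ^ 2 = c)
    (hX : 3 ∣ X) (hX' : 3 ∣ X') (hdX : 3 ^ (k + 1) ∣ X - X') (hdY : 3 ^ k ∣ Y - Y')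
    (hdW : 3 ^ k ∣ W - W') (hY : ¬ 3 ∣ Y) (hW : 3 ∣ W) :
    3 ^ (k + 1) ∣ Y - Y' := by
  have hW' : (3 : ℤ) ∣ W' := dvd_of_node W W' k hk hW hdW
  have hYsum : ¬ (3 : ℤ) ∣ Y + Y' := sum_not_dvd Y Y' k hk hY hdY
  have hcomb := node_combination X X' Y Y' W W' c k hs hs' hX hX' hdX
  have hWpart : (3 : ℤ) ^ (k + 1) ∣ (W - W') * (W + W') := by
    have := mul_dvd_mul hdW (dvd_add hW hW')
    calc (3 : ℤ) ^ (k + 1) = 3 ^ k * 3 := by ring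
      _ ∣ (W - W') * (W + W') := this
  have hYpart : (3 : ℤ) ^ (k + 1) ∣ (Y - Y') * (Y + Y') := by
    have := dvd_sub hcomb hWpart
    simpa using this
  have hcop : IsCoprime ((3 : ℤ) ^ (k + 1)) (Y + Y') :=
    IsCoprime.pow_left ((Prime.coprime_iff_not_dvd Int.prime_three).mpr hYsum)
  exact hcop.dvd_of_dvd_mul_right hYpart

/-- THEOREM TERNARY, IMAGINARY-camp case: `3 ∣ Y`, `W` a unit ⇒ the next `W`-digit is forced. -/
theorem forced_W_digit (X X' Y Y' W W' c : ℤ) (k : ℕ) (hk : 1 ≤ k)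
    (hs : X ^ 2 + 3 * Y ^ 2 + 3 * W ^ 2 = c) (hs' : X' ^ 2 + 3 * Y' ^ 2 + 3 * W' ^ 2 = c)
    (hX : 3 ∣ X) (hX' : 3 ∣ X') (hdX : 3 ^ (k + 1) ∣ X - X') (hdY : 3 ^ k ∣ Y - Y')
    (hdW : 3 ^ k ∣ W - W') (hY : 3 ∣ Y) (hW : ¬ 3 ∣ W) :
    3 ^ (k + 1) ∣ W - W' := by
  have hsw : X ^ 2 + 3 * W ^ 2 + 3 * Y ^ 2 = c := by linear_combination hs
  have hsw' : X' ^ 2 + 3 * W' ^ 2 + 3 * Y' ^ 2 = c := by linear_combination hs'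
  exact forced_Y_digit X X' W W' Y Y' c k hk hsw hsw' hX hX' hdX hdW hdY hW hY

/-- THEOREM TERNARY, √3 case (both `Y`, `W` units): writing the next digits as `Y - Y' = 3^k * a`,
`W - W' = 3^k * b`, the pair `(a, b) mod 3` lies on the line `a (Y + Y') + b (W + W') ≡ 0 (mod 3)`. -/
theorem forced_line (X X' Y Y' W W' c a b : ℤ) (k : ℕ)
    (hs : X ^ 2 + 3 * Y ^ 2 + 3 * W ^ 2 = c) (hs' : X' ^ 2 + 3 * Y' ^ 2 + 3 * W' ^ 2 = c)
    (hX : 3 ∣ X) (hX' : 3 ∣ X') (hdX : 3 ^ (k + 1) ∣ X - X')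
    (ha : Y - Y' = 3 ^ k * a) (hb : W - W' = 3 ^ k * b) :
    3 ∣ a * (Y + Y') + b * (W + W') := by
  have hcomb := node_combination X X' Y Y' W W' c k hs hs' hX hX' hdX
  rw [ha, hb] at hcomb
  have h2 : (3 : ℤ) ^ k * 3 ∣ 3 ^ k * (a * (Y + Y') + b * (W + W')) := by
    convert hcomb using 1 <;> ring
  exact (mul_dvd_mul_iff_left (pow_ne_zero k (by norm_num : (3 : ℤ) ≠ 0))).mp h2

/-- On a √3 node the line is a proper line: `(Y + Y', W + W')` is nonzero mod 3 (indeed both are units),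
so exactly three digit pairs `(a, b) ∈ 𝔽₃²` satisfy it. Counted in `ZMod 3`. -/
theorem line_card (p q : ZMod 3) (hp : p ≠ 0) :
    (Finset.univ.filter (fun ab : ZMod 3 × ZMod 3 => ab.1 * p + ab.2 * q = 0)).card = 3 := by
  revert p q; decide

/-- Root branching: the level-1 node has exactly four children in either universe —
`Y² + W² ≡ 1 (mod 3)` (ζ₃ type: the four points `(±1, 0), (0, ±1)`, i.e. the two camps with two signs) and
`Y² + W² ≡ 2 (mod 3)` (√3 type: `(±1, ±1)`). -/
theorem root_card_zeta3 :
    (Finset.univ.filter (fun yw : ZMod 3 × ZMod 3 => yw.1 ^ 2 + yw.2 ^ 2 = 1)).card = 4 := by decide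

/-- Root branching in the √3 universe: `Y² + W² ≡ 2 (mod 3)` has the four solutions `(±1, ±1)`. -/
theorem root_card_sqrt3 :
    (Finset.univ.filter (fun yw : ZMod 3 × ZMod 3 => yw.1 ^ 2 + yw.2 ^ 2 = 2)).card = 4 := by decide

/-- Camp dichotomy at the root of the ζ₃ universe: `Y² + W² ≡ 1 (mod 3)` forces exactly one of `Y`, `W` to be
a unit (REAL camp: `Y` unit; IMAGINARY camp: `W` unit). -/
theorem camp_dichotomy (y w : ZMod 3) (h : y ^ 2 + w ^ 2 = 1) : (y ≠ 0 ∧ w = 0) ∨ (y = 0 ∧ w ≠ 0) := by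
  revert y w h; decide

end Summit.HodgeConjecture.HodgeConjecture.HodgeLocus.Census.TernaryBranchB
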